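import Summits.ResolutionOfSingularities.ResolutionOfSingularities.Theorems.HilbertSamuelEliminationSigmaMaxModificationsCorridor3HelpersDefs
import Literature.AlgebraicGeometry.Resolution.HilbertSamuelStrata
import Mathlib.Data.Nat.Choose.Sum
import HarnessLib

/-!
# `SigmaMaxModificationsCorridor3` (crux stmt-ResolutionOfSingularities-19249, child of
# `SigmaMaxModifications` stmt-ResolutionOfSingularities-18506, route HilbertSamuelElimination),
# chain w42 helper H1″: LEVEL BOOKKEEPING FOR HYPERSURFACE VALUES

[OURS · L1 W4.2] Helper H1″ of the typed helper programme for `stub_tameNu3`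
(`run/shared/lean/pub/res-hironaka/L/w42/CRUX-PLAN.md` §2, `L/w42/helpers-v1.lean`:
`stub_H1_hilbertFun_stalk_of_mem_hsStratum`), proved, together with the arithmetic of the
hypersurface Hilbert functions `hypersurfaceHFe e m` (`…Corridor3HelpersDefs.lean`) that it rests
on. NOT a statement of any manuscript.

Recall `hypersurfaceHFe e m n = C(n+e-1, e-1) - [m ≤ n]·C(n-m+e-1, e-1)` — the Hilbert function
`H^{(0)}` of a hypersurface singularity of multiplicity `m` in embedding dimension `e ≥ 1` — and
Bennett's normalisation of the Hilbert–Samuel function of a point (CJS Def. 2.28):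
`H^N_Y(y) = H^{(N - ψ_Y(y))}(𝒪_{Y,y})`, `H^{(t)} = (H^{(0)})^{(t)}` the `t`-fold partial sum
(`Scheme.hsFun`, `hilbertSamuelFun`, `iterPSum`).

* `psum_hypersurfaceHFe_succ` : `(hypersurfaceHFe (t+1) m)^{(1)} = hypersurfaceHFe (t+2) m` —
  one partial summation raises the embedding dimension by one (Pascal's rule; the value does not
  remember the level it was read at); iterated: `iterPSum_hypersurfaceHFe_succ`.
* `hypersurfaceHFe_succ_one_eq_iterPSum_Phi` : multiplicity `1` is the regular value,
  `hypersurfaceHFe (t+1) 1 = Φ^{(t)}` (at level `3` this is the landed `TameWild.hypersurfaceHF_one`);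
  `hypersurfaceHFe_succ_apply_one` : `H(1) = e` for `m ≥ 2` (the embedding dimension is read off
  the value).
* **H1″** `hilbertFun_eq_hypersurfaceHFe_of_hsFun_eq` : if `ψ_Y(y) ≤ N` and
  `H^N_Y(y) = hypersurfaceHFe (N+1) m`, then `H^{(0)}(𝒪_{Y,y}) = hypersurfaceHFe (ψ_Y(y)+1) m`
  (`iterPSum_injective`); conversely `hsFun_eq_hypersurfaceHFe_of_hilbertFun_eq`; and the
  planner's form at level `3`, `stub_H1_hilbertFun_stalk_of_mem_hsStratum` (signature verbatim from
  `helpers-v1.lean`; `hypersurfaceHFe 4 = hypersurfaceHF` by `hypersurfaceHFe_four`).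

Use in the tame line: at a point `y` of a maximal stratum `Y(ν)`, `ν = hypersurfaceHF m`, the
local ring `𝒪_{Y,y}` has the Hilbert function of a hypersurface of multiplicity `m` in embedding
dimension `ψ_Y(y) + 1` — the input of H1 (Hilbert-function rigidity: `𝒪_{Y,y} ≅ S/(g)`, `S`
regular of dimension `ψ_Y(y) + 1`, `ord g = m`).

## Sources

* V. Cossart, U. Jannsen, S. Saito, LNM 2270 (2020): §2.2 (p. 27), Def. 2.13, Def. 2.28,
  Rem. 2.29 (b), Thm. 2.3. [CossartJannsenSaito2020]
-/

set_option linter.dupNamespace false -- mandated namespace of this single-conjunct summit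

noncomputable section

open AlgebraicGeometry
open Literature.RingTheory.HilbertSamuel Literature.AlgebraicGeometry.Resolution
open Summit.ResolutionOfSingularities.ResolutionOfSingularities.Theorems.SigmaMaxModificationsCorridor3.TameWild

namespace Summit.ResolutionOfSingularities.ResolutionOfSingularities.Theorems.SigmaMaxModificationsCorridor3.Helpers

universe u

/-! ## Arithmetic of the hypersurface Hilbert functions -/

/-- Below the multiplicity nothing is killed: `hypersurfaceHFe e m n = C(n+e-1, e-1)` for `n < m`.
[cite: CossartJannsenSaito2020, Def. 2.13] -/
theorem hypersurfaceHFe_apply_of_lt {e m n : ℕ} (h : n < m) :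
    hypersurfaceHFe e m n = (n + e - 1).choose (e - 1) := by
  rw [hypersurfaceHFe_apply, if_neg (by omega), Nat.sub_zero]

/-- The value at `0`: `1`, unless `m = 0` (everything killed). [cite: CossartJannsenSaito2020, Def. 2.13] -/
theorem hypersurfaceHFe_succ_apply_zero (t m : ℕ) :
    hypersurfaceHFe (t + 1) m 0 = if m = 0 then 0 else 1 := by
  rw [hypersurfaceHFe_apply]
  have e1 : 0 + (t + 1) - 1 = t := by omega
  have e2 : t + 1 - 1 = t := by omega
  have e3 : 0 - m + (t + 1) - 1 = t := by omega
  rw [e1, e2, e3, Nat.choose_self]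
  by_cases hm : m = 0
  · subst hm
    simp
  · rw [if_neg (by omega), if_neg hm]

/-- **`H(1) = e` for multiplicity `m ≥ 2`:** the embedding dimension is read off the value.
[cite: CossartJannsenSaito2020, Thm. 2.3] -/
theorem hypersurfaceHFe_succ_apply_one {t m : ℕ} (hm : 2 ≤ m) :
    hypersurfaceHFe (t + 1) m 1 = t + 1 := by
  rw [hypersurfaceHFe_apply_of_lt (by omega)]
  have e1 : 1 + (t + 1) - 1 = t + 1 := by omega
  have e2 : t + 1 - 1 = t := by omega
  rw [e1, e2, Nat.choose_succ_self_right]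

/-- **Pascal's rule for the hypersurface Hilbert functions:**
`hypersurfaceHFe (t+2) m (n+1) = hypersurfaceHFe (t+2) m n + hypersurfaceHFe (t+1) m (n+1)`.
[cite: CossartJannsenSaito2020, Def. 2.13] -/
theorem hypersurfaceHFe_succ_succ_apply_succ (t m n : ℕ) :
    hypersurfaceHFe (t + 2) m (n + 1) =
      hypersurfaceHFe (t + 2) m n + hypersurfaceHFe (t + 1) m (n + 1) := by
  simp only [hypersurfaceHFe_apply]
  have e1 : n + 1 + (t + 2) - 1 = n + t + 1 + 1 := by omega
  have e2 : t + 2 - 1 = t + 1 := by omega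
  have e3 : n + (t + 2) - 1 = n + t + 1 := by omega
  have e4 : n + 1 + (t + 1) - 1 = n + t + 1 := by omega
  have e5 : t + 1 - 1 = t := by omega
  rw [e1, e2, e3, e4, e5]
  have p1 : (n + t + 1 + 1).choose (t + 1) = (n + t + 1).choose t + (n + t + 1).choose (t + 1) :=
    Nat.choose_succ_succ _ _
  by_cases hmn : m ≤ n
  · have h1 : m ≤ n + 1 := by omega
    simp only [if_pos h1, if_pos hmn]
    have e6 : n + 1 - m + (t + 2) - 1 = n - m + t + 1 + 1 := by omega
    have e7 : n - m + (t + 2) - 1 = n - m + t + 1 := by omega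
    have e8 : n + 1 - m + (t + 1) - 1 = n - m + t + 1 := by omega
    rw [e6, e7, e8]
    have p2 : (n - m + t + 1 + 1).choose (t + 1) =
        (n - m + t + 1).choose t + (n - m + t + 1).choose (t + 1) :=
      Nat.choose_succ_succ _ _
    have i1 : (n - m + t + 1).choose (t + 1) ≤ (n + t + 1).choose (t + 1) :=
      Nat.choose_le_choose _ (by omega)
    have i2 : (n - m + t + 1).choose t ≤ (n + t + 1).choose t :=
      Nat.choose_le_choose _ (by omega)
    omega
  · by_cases hm1 : m ≤ n + 1
    · simp only [if_pos hm1, if_neg hmn]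
      have e6 : n + 1 - m + (t + 2) - 1 = t + 1 := by omega
      have e8 : n + 1 - m + (t + 1) - 1 = t := by omega
      rw [e6, e8, Nat.choose_self, Nat.choose_self]
      have i1 : 1 ≤ (n + t + 1).choose (t + 1) := Nat.succ_le_of_lt (Nat.choose_pos (by omega))
      have i2 : 1 ≤ (n + t + 1).choose t := Nat.succ_le_of_lt (Nat.choose_pos (by omega))
      omega
    · simp only [if_neg hm1, if_neg hmn]
      omega

/-- **One partial summation raises the embedding dimension by one:**
`(hypersurfaceHFe (t+1) m)^{(1)} = hypersurfaceHFe (t+2) m` — the Hilbert function of a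
hypersurface of multiplicity `m` in a regular local ring of dimension `t + 2` is the first partial
sum of the one in dimension `t + 1` (CJS Rem. 2.29 (b): `H^{(t)}` of `𝒪` is `H^{(0)}` of
`𝒪[[T₁,…,T_t]]`). [cite: CossartJannsenSaito2020, Def. 2.13, Rem. 2.29 (b)] -/
theorem psum_hypersurfaceHFe_succ (t m : ℕ) :
    psum (hypersurfaceHFe (t + 1) m) = hypersurfaceHFe (t + 2) m := by
  funext n
  induction n with
  | zero =>
    rw [psum_apply, Finset.sum_range_one, hypersurfaceHFe_succ_apply_zero,
      show t + 2 = (t + 1) + 1 from rfl, hypersurfaceHFe_succ_apply_zero]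
  | succ n ih => rw [psum_succ, ih, hypersurfaceHFe_succ_succ_apply_succ]

/-- Iterated: `(hypersurfaceHFe (t+1) m)^{(s)} = hypersurfaceHFe (t+1+s) m`.
[cite: CossartJannsenSaito2020, Def. 2.13, Rem. 2.29 (b)] -/
theorem iterPSum_hypersurfaceHFe_succ (s t m : ℕ) :
    iterPSum s (hypersurfaceHFe (t + 1) m) = hypersurfaceHFe (t + 1 + s) m := by
  induction s with
  | zero => rw [iterPSum_zero, Nat.add_zero]
  | succ s ih =>
    rw [iterPSum_succ, ih, show t + 1 + s = (t + s) + 1 by omega, psum_hypersurfaceHFe_succ,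
      show t + s + 2 = t + 1 + (s + 1) by omega]

/-- **Multiplicity `1` is the regular value:** `hypersurfaceHFe (t+1) 1 = Φ^{(t)}`
(`C(n+t, t) - C(n+t-1, t) = C(n+t-1, t-1)`; a hypersurface of order `1` in a regular local ring of
dimension `t + 1` is regular of dimension `t`). [cite: CossartJannsenSaito2020, Def. 2.13, Lemma 2.31] -/
theorem hypersurfaceHFe_succ_one_eq_iterPSum_Phi (t : ℕ) :
    hypersurfaceHFe (t + 1) 1 = iterPSum t Phi := by
  induction t with
  | zero =>
    funext n
    rw [hypersurfaceHFe_apply, iterPSum_zero]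
    rcases Nat.eq_zero_or_pos n with rfl | hn
    · simp [Phi]
    · rw [if_pos (show 1 ≤ n from hn), Phi_of_ne_zero (by omega)]
      simp
  | succ t ih => rw [← psum_hypersurfaceHFe_succ, ih, ← iterPSum_succ]

/-- Multiplicity `0` kills everything: `hypersurfaceHFe e 0 = 0`. [folklore] -/
theorem hypersurfaceHFe_zero_right (e : ℕ) : hypersurfaceHFe e 0 = 0 := by
  funext n
  rw [hypersurfaceHFe_apply, if_pos (Nat.zero_le n), Nat.sub_zero, Nat.sub_self]
  rfl

/-! ## H1″: level bookkeeping at a point of a hypersurface stratum -/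

/-- **H1″ (general level).** If `ψ_Y(y) ≤ N` and the level-`N` Hilbert–Samuel function of `Y` at
`y` is the hypersurface value `hypersurfaceHFe (N+1) m`, then the local ring `𝒪_{Y,y}` has the
Hilbert function `H^{(0)}` of a hypersurface of multiplicity `m` in embedding dimension `ψ_Y(y) + 1`:
`H^N_Y(y) = (H^{(0)}(𝒪_{Y,y}))^{(N - ψ)}` (Def. 2.28),
`hypersurfaceHFe (N+1) m = (hypersurfaceHFe (ψ+1) m)^{(N-ψ)}` (`iterPSum_hypersurfaceHFe_succ`),
and partial summation is injective (`iterPSum_injective`).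
[cite: CossartJannsenSaito2020, Def. 2.28, Rem. 2.29 (b)] -/
theorem hilbertFun_eq_hypersurfaceHFe_of_hsFun_eq {Y : Scheme.{u}} {N m : ℕ} {y : Y}
    (hψ : Scheme.hsPsi Y y ≤ N) (hy : Scheme.hsFun Y N y = hypersurfaceHFe (N + 1) m) :
    hilbertFun (Y.presheaf.stalk y) = hypersurfaceHFe (Scheme.hsPsi Y y + 1) m := by
  apply iterPSum_injective (N - Scheme.hsPsi Y y)
  rw [iterPSum_hypersurfaceHFe_succ,
    show Scheme.hsPsi Y y + 1 + (N - Scheme.hsPsi Y y) = N + 1 by omega, ← hy, Scheme.hsFun_def]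
  rfl

/-- **Converse of H1″.** If `ψ_Y(y) ≤ N` and `H^{(0)}(𝒪_{Y,y}) = hypersurfaceHFe (ψ_Y(y)+1) m`, then
`H^N_Y(y) = hypersurfaceHFe (N+1) m`. [cite: CossartJannsenSaito2020, Def. 2.28, Rem. 2.29 (b)] -/
theorem hsFun_eq_hypersurfaceHFe_of_hilbertFun_eq {Y : Scheme.{u}} {N m : ℕ} {y : Y}
    (hψ : Scheme.hsPsi Y y ≤ N)
    (hy : hilbertFun (Y.presheaf.stalk y) = hypersurfaceHFe (Scheme.hsPsi Y y + 1) m) :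
    Scheme.hsFun Y N y = hypersurfaceHFe (N + 1) m := by
  rw [Scheme.hsFun_def, show hilbertSamuelFun (Y.presheaf.stalk y) (N - Scheme.hsPsi Y y) =
    iterPSum (N - Scheme.hsPsi Y y) (hilbertFun (Y.presheaf.stalk y)) from rfl, hy,
    iterPSum_hypersurfaceHFe_succ, show Scheme.hsPsi Y y + 1 + (N - Scheme.hsPsi Y y) = N + 1 by omega]

/-- **H1″ at a point of a hypersurface stratum (general level):** membership in the stratum
`Y(hypersurfaceHFe (N+1) m)` at level `N ≥ ψ_Y(y)` is equivalent to
`H^{(0)}(𝒪_{Y,y}) = hypersurfaceHFe (ψ_Y(y)+1) m`. [cite: CossartJannsenSaito2020, Def. 2.28, Rem. 2.29 (b)] -/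
theorem mem_hsStratum_hypersurfaceHFe_iff {Y : Scheme.{u}} {N m : ℕ} {y : Y}
    (hψ : Scheme.hsPsi Y y ≤ N) :
    y ∈ Scheme.hsStratum Y N (hypersurfaceHFe (N + 1) m) ↔
      hilbertFun (Y.presheaf.stalk y) = hypersurfaceHFe (Scheme.hsPsi Y y + 1) m := by
  rw [Scheme.mem_hsStratum_iff]
  exact ⟨hilbertFun_eq_hypersurfaceHFe_of_hsFun_eq hψ, hsFun_eq_hypersurfaceHFe_of_hilbertFun_eq hψ⟩

/-- **H1″ (the planner's form, `L/w42/helpers-v1.lean`, signature verbatim): at a point `y` of the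
stratum `Y(hypersurfaceHF m)` at level `3` with `ψ_Y(y) ≤ 3`, the local ring has the Hilbert
function of a hypersurface of multiplicity `m` in embedding dimension `ψ_Y(y) + 1`.**
(`hypersurfaceHF m = hypersurfaceHFe 4 m`, then `hilbertFun_eq_hypersurfaceHFe_of_hsFun_eq`.)
[cite: CossartJannsenSaito2020, Def. 2.28, Rem. 2.29 (b), Thm. 2.3] -/
theorem stub_H1_hilbertFun_stalk_of_mem_hsStratum {Y : Scheme.{u}} {m : ℕ} {y : Y}
    (hy : y ∈ Scheme.hsStratum Y 3 (hypersurfaceHF m)) (hψ : Scheme.hsPsi Y y ≤ 3) :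
    hilbertFun (Y.presheaf.stalk y) = hypersurfaceHFe (Scheme.hsPsi Y y + 1) m := by
  rw [← hypersurfaceHFe_four, Scheme.mem_hsStratum_iff] at hy
  exact hilbertFun_eq_hypersurfaceHFe_of_hsFun_eq hψ hy

/-- **Embedding dimension at a point of a hypersurface stratum:** for `m ≥ 2`,
`H^{(0)}(𝒪_{Y,y})(1) = dim_κ 𝔪/𝔪² = ψ_Y(y) + 1`. [cite: CossartJannsenSaito2020, Def. 2.28, Thm. 2.3] -/
theorem hilbertFun_stalk_one_of_mem_hsStratum {Y : Scheme.{u}} {N m : ℕ} {y : Y}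
    (hψ : Scheme.hsPsi Y y ≤ N) (hm : 2 ≤ m)
    (hy : y ∈ Scheme.hsStratum Y N (hypersurfaceHFe (N + 1) m)) :
    hilbertFun (Y.presheaf.stalk y) 1 = Scheme.hsPsi Y y + 1 := by
  rw [(mem_hsStratum_hypersurfaceHFe_iff hψ).mp hy, hypersurfaceHFe_succ_apply_one hm]

end Summit.ResolutionOfSingularities.ResolutionOfSingularities.Theorems.SigmaMaxModificationsCorridor3.Helpers

end
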